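import Mathlib
import Literature.Analysis.FunctionSpaces.SobolevTracePoincareProofs
import HarnessLib

/-!
# The mean-value potential estimate on a ball (Gilbarg–Trudinger, Lemma 7.16)

Analysis/FunctionSpaces support file (everything proved).  On a finite-dimensional real normed space `E`
(`n = dim E ≥ 1`) with an additive Haar measure `μ`: for `f ∈ C¹(E)`, a ball `B = B(c, R)`, a measurable
`S ⊆ B` of positive measure and every `x ∈ B`,

  `|f(x) − ⨍_S f| ≤ ((2R)ⁿ / (n μ(S))) ∫_B ‖Df(z)‖ ‖z − x‖^{1−n} dz`

(`enorm_sub_setAverage_le_potential`, stated in `ℝ≥0∞` so that no integrability hypothesis is needed).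
This is Lemma 7.16 of Gilbarg–Trudinger for the convex domain `Ω = B` (`d = diam B = 2R`), the first step of
Sobolev/Morrey/Trudinger estimates by Riesz potentials.  Proof (loc. cit.): `f(y) − f(x) = ∫₀¹ Df(x + t(y−x))[y−x] dt`,
integrate over `y ∈ S`, Tonelli, the homothety `y ↦ z = x + t(y − x)` (Jacobian `tⁿ`, image inside `B ∩ B(x, 2Rt)` by
convexity), Tonelli again and `∫_{‖z−x‖/2R}^1 t^{−n−1} dt ≤ (2R)ⁿ/(n‖z−x‖ⁿ)`.

## Mathlib / tree search
Mathlib (this pin): Haar scaling `Measure.map_addHaar_smul`, FTC `intervalIntegral.integral_eq_sub_of_hasDerivAt`,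
`lintegral_lintegral_swap`; no Riesz-potential estimates.  Tree: `enorm_sub_setAverage_le` (`SobolevTracePoincareProofs`, reused),
Poincaré–Wirtinger / Sobolev on Lipschitz domains (`SobolevPoincareBall`, qualitative constants only); nothing with the explicit
potential kernel.

[cite: GilbargTrudinger2001, Lemma 7.16]
-/

noncomputable section

open MeasureTheory Set Filter Metric Function Module
open scoped ENNReal NNReal Topology

namespace Literature.Analysis.FunctionSpaces

variable {E : Type*} [NormedAddCommGroup E] [NormedSpace ℝ E] [FiniteDimensional ℝ E]
  [MeasurableSpace E] [BorelSpace E]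

section Segment

omit [FiniteDimensional ℝ E] [MeasurableSpace E] [BorelSpace E] in
/-- **FTC along a segment, `ℝ≥0∞` form**: for `f ∈ C¹`, `‖f y − f x‖ ≤ ∫₀¹ ‖Df(x + t(y−x))[y − x]‖ dt`.
[cite: GilbargTrudinger2001, Lemma 7.16 (proof, first display)] -/
theorem enorm_sub_le_lintegral_fderiv_segment {F : Type*} [NormedAddCommGroup F] [NormedSpace ℝ F] [CompleteSpace F]
    {f : E → F} (hf : ContDiff ℝ 1 f) (x y : E) :
    ‖f y - f x‖ₑ ≤ ∫⁻ t in Ioc (0 : ℝ) 1, ‖fderiv ℝ f (x + t • (y - x)) (y - x)‖ₑ := by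
  -- the path and its derivative
  have hγ : ∀ t : ℝ, HasDerivAt (fun t : ℝ => x + t • (y - x)) (y - x) t := fun t => by
    have h := ((hasDerivAt_id t).smul_const (y - x)).const_add x
    simpa using h
  have hd : ∀ t : ℝ, HasDerivAt (fun t : ℝ => f (x + t • (y - x))) (fderiv ℝ f (x + t • (y - x)) (y - x)) t := fun t =>
    (((hf.differentiable (by simp)) _).hasFDerivAt).comp_hasDerivAt t (hγ t)
  have hc : Continuous fun t : ℝ => fderiv ℝ f (x + t • (y - x)) (y - x) :=
    ((hf.continuous_fderiv one_ne_zero).comp (continuous_const.add (continuous_id.smul continuous_const))).clm_apply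
      continuous_const
  have hftc := intervalIntegral.integral_eq_sub_of_hasDerivAt (a := 0) (b := 1) (fun t _ => hd t) (hc.intervalIntegrable _ _)
  simp only [zero_smul, add_zero, one_smul, add_sub_cancel] at hftc
  rw [← hftc, intervalIntegral.integral_of_le zero_le_one]
  exact enorm_integral_le_lintegral_enorm _

end Segment

section Scaling

variable (μ : Measure E) [μ.IsAddHaarMeasure]

/-- **Haar scaling of a homothety about `x`**: `∫ Φ(x + t(y − x)) dy = |t|^{−n} ∫ Φ` (`t ≠ 0`).
[cite: GilbargTrudinger2001, Lemma 7.16 (proof, change of variables)] -/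
theorem lintegral_comp_homothety {t : ℝ} (ht : t ≠ 0) (x : E) (Φ : E → ℝ≥0∞) :
    ∫⁻ y, Φ (x + t • (y - x)) ∂μ = ENNReal.ofReal |(t ^ finrank ℝ E)⁻¹| * ∫⁻ z, Φ z ∂μ := by
  have h1 : ∫⁻ y, Φ (x + t • (y - x)) ∂μ = ∫⁻ w, Φ (x + t • w) ∂μ :=
    lintegral_sub_right_eq_self (fun w => Φ (x + t • w)) x
  have h2 : ∫⁻ w, Φ (x + t • w) ∂μ = ENNReal.ofReal |(t ^ finrank ℝ E)⁻¹| * ∫⁻ v, Φ (x + v) ∂μ := by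
    have hmap := Measure.map_addHaar_smul μ ht
    have h := lintegral_map_equiv (μ := μ) (fun v => Φ (x + v)) (Homeomorph.smulOfNeZero t ht).toMeasurableEquiv
    have e : ⇑(Homeomorph.smulOfNeZero t ht).toMeasurableEquiv = fun w : E => t • w := rfl
    rw [e, hmap, lintegral_smul_measure] at h
    simpa using h.symm
  rw [h1, h2, lintegral_add_left_eq_self]

end Scaling

section TIntegral

/-- The `t`-integral of the proof: for `0 < ρ`, `0 < d`, `1 ≤ n`,
`∫_{(0,1]} 1_{ρ < t d} t^{−(n+1)} dt ≤ dⁿ / (n ρⁿ)`. [cite: GilbargTrudinger2001, Lemma 7.16 (proof, last display)] -/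
theorem lintegral_Ioc_indicator_inv_pow_le {n : ℕ} (hn : 1 ≤ n) {ρ d : ℝ} (hρ : 0 < ρ) (hd : 0 < d) :
    ∫⁻ t in Ioc (0 : ℝ) 1, (Ioi (ρ / d)).indicator (fun t => ENNReal.ofReal (t⁻¹ ^ (n + 1))) t ≤
      ENNReal.ofReal (d ^ n / (n * ρ ^ n)) := by
  have hρd : 0 < ρ / d := div_pos hρ hd
  -- reduce to the interval `(ρ/d, 1]`
  rw [lintegral_indicator measurableSet_Ioi, Measure.restrict_restrict measurableSet_Ioi]
  by_cases hle : 1 ≤ ρ / d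
  · have h0 : Ioi (ρ / d) ∩ Ioc (0 : ℝ) 1 = ∅ := by
      ext t; simp only [mem_inter_iff, mem_Ioi, mem_Ioc, mem_empty_iff_false, iff_false, not_and, not_le]
      intro h1 _; linarith
    rw [h0, Measure.restrict_empty, lintegral_zero_measure]
    exact bot_le
  rw [not_le] at hle
  have hI : Ioi (ρ / d) ∩ Ioc (0 : ℝ) 1 = Ioc (ρ / d) 1 := by
    ext t; simp only [mem_inter_iff, mem_Ioi, mem_Ioc]
    constructor
    · rintro ⟨h1, -, h2⟩; exact ⟨h1, h2⟩
    · rintro ⟨h1, h2⟩; exact ⟨h1, hρd.trans h1, h2⟩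
  rw [hI]
  -- compare with the primitive `t ↦ -t^{-n}/n`
  have hcont : ContinuousOn (fun t : ℝ => t⁻¹ ^ (n + 1)) (Icc (ρ / d) 1) :=
    (continuousOn_inv₀.mono fun t ht => (hρd.trans_le ht.1).ne').pow _
  have hint : IntegrableOn (fun t : ℝ => t⁻¹ ^ (n + 1)) (Ioc (ρ / d) 1) volume :=
    (hcont.integrableOn_Icc).mono_set Ioc_subset_Icc_self
  have hnn : ∀ t ∈ Ioc (ρ / d) 1, 0 ≤ t⁻¹ ^ (n + 1) := fun t ht => pow_nonneg (inv_nonneg.2 (hρd.trans ht.1).le) _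
  rw [← ofReal_integral_eq_lintegral_ofReal hint (ae_restrict_of_forall_mem measurableSet_Ioc hnn)]
  refine ENNReal.ofReal_le_ofReal ?_
  -- `∫_{a}^{1} t^{-(n+1)} dt = (a^{-n} - 1)/n ≤ a^{-n}/n = dⁿ/(n ρⁿ)`
  have hderiv : ∀ t ∈ uIcc (ρ / d) 1, HasDerivAt (fun t : ℝ => -(t⁻¹ ^ n) / n) (t⁻¹ ^ (n + 1)) t := by
    intro t ht
    rw [uIcc_of_le hle.le] at ht
    have ht0 : t ≠ 0 := (hρd.trans_le ht.1).ne'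
    have h1 : HasDerivAt (fun t : ℝ => t⁻¹) (-(t ^ 2)⁻¹) t := hasDerivAt_inv ht0
    have h2 : HasDerivAt (fun t : ℝ => t⁻¹ ^ n) ((n : ℝ) * t⁻¹ ^ (n - 1) * (-(t ^ 2)⁻¹)) t := h1.pow n
    have h3 : HasDerivAt (fun t : ℝ => -(t⁻¹ ^ n) / n) (-((n : ℝ) * t⁻¹ ^ (n - 1) * (-(t ^ 2)⁻¹)) / n) t :=
      (h2.neg).div_const (n : ℝ)
    refine h3.congr_deriv ?_
    have hn0 : (n : ℝ) ≠ 0 := by exact_mod_cast (Nat.one_le_iff_ne_zero.1 hn)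
    obtain ⟨m, rfl⟩ : ∃ m, n = m + 1 := ⟨n - 1, (Nat.sub_add_cancel hn).symm⟩
    rw [Nat.add_sub_cancel]
    have e2 : (t ^ 2)⁻¹ = t⁻¹ ^ 2 := by rw [inv_pow]
    rw [e2]
    have e3 : -(((m + 1 : ℕ) : ℝ) * t⁻¹ ^ m * -(t⁻¹ ^ 2)) / ((m + 1 : ℕ) : ℝ) = t⁻¹ ^ m * t⁻¹ ^ 2 := by
      rw [mul_neg, neg_neg, mul_assoc, mul_div_cancel_left₀ _ hn0]
    rw [e3]
    ring
  have hftc := intervalIntegral.integral_eq_sub_of_hasDerivAt hderiv (hcont.intervalIntegrable_of_Icc hle.le)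
  rw [intervalIntegral.integral_of_le hle.le] at hftc
  rw [hftc]
  have hn0 : (0 : ℝ) < n := by exact_mod_cast hn
  have e1 : (ρ / d)⁻¹ ^ n = d ^ n / ρ ^ n := by rw [inv_div, div_pow]
  rw [inv_one, one_pow, e1]
  have : 0 ≤ (1 : ℝ) / n := by positivity
  calc -1 / (n : ℝ) - -(d ^ n / ρ ^ n) / n = d ^ n / (n * ρ ^ n) - 1 / n := by field_simp; ring
    _ ≤ d ^ n / (n * ρ ^ n) := by linarith

end TIntegral

section Main

variable (μ : Measure E) [μ.IsAddHaarMeasure]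

/-- **GILBARG–TRUDINGER, LEMMA 7.16 (ball version, `C¹` functions).**  For `f ∈ C¹(E)`, `n = dim E ≥ 1`, a measurable
`S ⊆ B(c, R)` of positive measure and `x ∈ B(c, R)`:
`‖f x − ⨍_S f‖ ≤ ((2R)ⁿ/n) / μ(S) · ∫_{B(c,R)} ‖Df z‖ ‖z − x‖^{1−n} dz` (in `ℝ≥0∞`).
[cite: GilbargTrudinger2001, Lemma 7.16] -/
theorem enorm_sub_setAverage_le_potential (hn : 1 ≤ finrank ℝ E) {f : E → ℝ} (hf : ContDiff ℝ 1 f)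
    {c : E} {R : ℝ} {S : Set E} (hS : MeasurableSet S) (hSB : S ⊆ ball c R) (hS0 : μ S ≠ 0) {x : E}
    (hx : x ∈ ball c R) :
    ‖f x - ⨍ y in S, f y ∂μ‖ₑ ≤
      ENNReal.ofReal ((2 * R) ^ finrank ℝ E / finrank ℝ E) / μ S *
        ∫⁻ z in ball c R, ‖fderiv ℝ f z‖ₑ * ENNReal.ofReal (‖z - x‖⁻¹ ^ (finrank ℝ E - 1)) ∂μ := by
  set n := finrank ℝ E with hndef
  set d : ℝ := 2 * R with hddef
  have hR : 0 < R := by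
    have h := mem_ball.1 hx
    exact lt_of_le_of_lt dist_nonneg h
  have hd : 0 < d := by positivity
  have hStop : μ S ≠ ⊤ := ((measure_mono hSB).trans_lt measure_ball_lt_top).ne
  have hDfc : Continuous (fderiv ℝ f) := hf.continuous_fderiv one_ne_zero
  -- the kernel in the variables `(t, z)`
  obtain ⟨K, hKdef⟩ : ∃ K : ℝ → E → ℝ≥0∞, K = fun t z =>
      (Ioi (‖z - x‖ / d)).indicator (fun t : ℝ => ENNReal.ofReal (t⁻¹ ^ (n + 1))) t * (‖fderiv ℝ f z‖ₑ * ‖z - x‖ₑ) :=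
    ⟨_, rfl⟩
  -- ### Step A: averages
  have hfi : IntegrableOn f S μ :=
    (hf.continuous.continuousOn.integrableOn_compact (isCompact_closedBall c R)).mono_set
      (hSB.trans ball_subset_closedBall)
  -- ### Step B: FTC along segments, and Tonelli
  have hB : ∫⁻ y in S, ‖f y - f x‖ₑ ∂μ ≤
      ∫⁻ t in Ioc (0 : ℝ) 1, (∫⁻ y in S, ‖fderiv ℝ f (x + t • (y - x)) (y - x)‖ₑ ∂μ) := by
    calc ∫⁻ y in S, ‖f y - f x‖ₑ ∂μ ≤ ∫⁻ y in S, (∫⁻ t in Ioc (0 : ℝ) 1, ‖fderiv ℝ f (x + t • (y - x)) (y - x)‖ₑ) ∂μ :=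
          lintegral_mono fun y => enorm_sub_le_lintegral_fderiv_segment hf x y
      _ = ∫⁻ t in Ioc (0 : ℝ) 1, (∫⁻ y in S, ‖fderiv ℝ f (x + t • (y - x)) (y - x)‖ₑ ∂μ) := by
          refine lintegral_lintegral_swap ?_
          have hc : Continuous fun p : E × ℝ => fderiv ℝ f (x + p.2 • (p.1 - x)) (p.1 - x) :=
            (hDfc.comp (continuous_const.add (continuous_snd.smul (continuous_fst.sub continuous_const)))).clm_apply
              (continuous_fst.sub continuous_const)
          exact hc.measurable.enorm.aemeasurable
  -- ### Step C: the homothety, for each `t ∈ (0,1]`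
  have hK : ∀ t ∈ Ioc (0 : ℝ) 1, ∫⁻ y in S, ‖fderiv ℝ f (x + t • (y - x)) (y - x)‖ₑ ∂μ ≤ ∫⁻ z in ball c R, K t z ∂μ := by
    intro t ht
    have ht0 : 0 < t := ht.1
    -- the dominating function of `z`
    obtain ⟨Ψ, hΨ⟩ : ∃ Ψ : E → ℝ≥0∞, Ψ = fun z => (ball c R).indicator (K t) z := ⟨_, rfl⟩
    have hpt : ∀ y ∈ S, ‖fderiv ℝ f (x + t • (y - x)) (y - x)‖ₑ ≤ ENNReal.ofReal (t ^ n) * Ψ (x + t • (y - x)) := by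
      intro y hy
      have hyB : y ∈ ball c R := hSB hy
      have hzB : x + t • (y - x) ∈ ball c R := (convex_ball c R).add_smul_sub_mem hx hyB ⟨ht0.le, ht.2⟩
      have hyx : ‖y - x‖ < d := by
        calc ‖y - x‖ = dist y x := (dist_eq_norm _ _).symm
          _ ≤ dist y c + dist x c := dist_triangle_right _ _ _
          _ < R + R := add_lt_add (mem_ball.1 hyB) (mem_ball.1 hx)
          _ = d := by rw [hddef]; ring
      have hzx : ‖x + t • (y - x) - x‖ = t * ‖y - x‖ := by
        rw [add_sub_cancel_left, norm_smul, Real.norm_of_nonneg ht0.le]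
      have hzx' : ‖x + t • (y - x) - x‖ₑ = ENNReal.ofReal t * ‖y - x‖ₑ := by
        rw [← ofReal_norm, hzx, ENNReal.ofReal_mul ht0.le, ofReal_norm]
      have hmem : t ∈ Ioi (‖x + t • (y - x) - x‖ / d) := by
        rw [mem_Ioi, hzx, div_lt_iff₀ hd]
        exact mul_lt_mul_of_pos_left hyx ht0
      rw [hΨ, hKdef]
      simp only [indicator_of_mem hzB, indicator_of_mem hmem]
      rw [hzx']
      have e : ENNReal.ofReal (t ^ n) * ENNReal.ofReal (t⁻¹ ^ (n + 1)) * ENNReal.ofReal t = 1 := by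
        rw [← ENNReal.ofReal_mul (pow_nonneg ht0.le _), ← ENNReal.ofReal_mul (by positivity), ← ENNReal.ofReal_one]
        congr 1
        rw [pow_succ, inv_pow]
        field_simp
      calc ‖fderiv ℝ f (x + t • (y - x)) (y - x)‖ₑ ≤ ‖fderiv ℝ f (x + t • (y - x))‖ₑ * ‖y - x‖ₑ := by
            rw [← ofReal_norm, ← ofReal_norm, ← ofReal_norm, ← ENNReal.ofReal_mul (norm_nonneg _)]
            exact ENNReal.ofReal_le_ofReal ((fderiv ℝ f (x + t • (y - x))).le_opNorm _)
        _ = (ENNReal.ofReal (t ^ n) * ENNReal.ofReal (t⁻¹ ^ (n + 1)) * ENNReal.ofReal t) *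
              (‖fderiv ℝ f (x + t • (y - x))‖ₑ * ‖y - x‖ₑ) := by rw [e, one_mul]
        _ = ENNReal.ofReal (t ^ n) * (ENNReal.ofReal (t⁻¹ ^ (n + 1)) *
              (‖fderiv ℝ f (x + t • (y - x))‖ₑ * (ENNReal.ofReal t * ‖y - x‖ₑ))) := by ring
    have hΨm : ∫⁻ y, ENNReal.ofReal (t ^ n) * Ψ (x + t • (y - x)) ∂μ = ENNReal.ofReal (t ^ n) * ∫⁻ y, Ψ (x + t • (y - x)) ∂μ :=
      lintegral_const_mul' _ _ ENNReal.ofReal_ne_top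
    calc ∫⁻ y in S, ‖fderiv ℝ f (x + t • (y - x)) (y - x)‖ₑ ∂μ
        ≤ ∫⁻ y in S, ENNReal.ofReal (t ^ n) * Ψ (x + t • (y - x)) ∂μ := setLIntegral_mono' hS hpt
      _ ≤ ∫⁻ y, ENNReal.ofReal (t ^ n) * Ψ (x + t • (y - x)) ∂μ := setLIntegral_le_lintegral _ _
      _ = ENNReal.ofReal (t ^ n) * (ENNReal.ofReal |(t ^ n)⁻¹| * ∫⁻ z, Ψ z ∂μ) := by
          rw [hΨm, lintegral_comp_homothety μ ht0.ne' x Ψ]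
      _ = ∫⁻ z, Ψ z ∂μ := by
          rw [← mul_assoc, ← ENNReal.ofReal_mul (pow_nonneg ht0.le _), abs_of_pos (inv_pos.2 (pow_pos ht0 _)),
            mul_inv_cancel₀ (pow_pos ht0 _).ne', ENNReal.ofReal_one, one_mul]
      _ = ∫⁻ z in ball c R, K t z ∂μ := by rw [hΨ, lintegral_indicator measurableSet_ball]
  -- ### Step D: Tonelli again and the `t`-integral
  have hKm : Measurable (uncurry K) := by
    rw [hKdef]
    have h1 : Measurable fun p : ℝ × E => (Ioi (‖p.2 - x‖ / d)).indicator (fun t : ℝ => ENNReal.ofReal (t⁻¹ ^ (n + 1))) p.1 := by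
      have e : (fun p : ℝ × E => (Ioi (‖p.2 - x‖ / d)).indicator (fun t : ℝ => ENNReal.ofReal (t⁻¹ ^ (n + 1))) p.1) =
          {p : ℝ × E | ‖p.2 - x‖ / d < p.1}.indicator fun p => ENNReal.ofReal (p.1⁻¹ ^ (n + 1)) := by
        funext p
        simp only [Set.indicator_apply, mem_Ioi, mem_setOf_eq]
      rw [e]
      refine Measurable.indicator ?_ ?_
      · exact (measurable_fst.inv.pow_const _).ennreal_ofReal
      · exact measurableSet_lt ((measurable_snd.sub_const x).norm.div_const d) measurable_fst
    exact h1.mul ((hDfc.measurable.comp measurable_snd).enorm.mul (measurable_snd.sub_const x).enorm)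
  have hD : ∫⁻ t in Ioc (0 : ℝ) 1, (∫⁻ z in ball c R, K t z ∂μ) = ∫⁻ z in ball c R, (∫⁻ t in Ioc (0 : ℝ) 1, K t z) ∂μ :=
    lintegral_lintegral_swap hKm.aemeasurable
  have hE : ∀ z, ∫⁻ t in Ioc (0 : ℝ) 1, K t z ≤
      ENNReal.ofReal (d ^ n / n) * (‖fderiv ℝ f z‖ₑ * ENNReal.ofReal (‖z - x‖⁻¹ ^ (n - 1))) := by
    intro z
    rw [hKdef]
    dsimp only
    rw [lintegral_mul_const' _ _ (by finiteness)]
    by_cases hzx : z = x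
    · subst hzx
      simp
    have hρ : 0 < ‖z - x‖ := norm_pos_iff.2 (sub_ne_zero.2 hzx)
    calc (∫⁻ t in Ioc (0 : ℝ) 1, (Ioi (‖z - x‖ / d)).indicator (fun t : ℝ => ENNReal.ofReal (t⁻¹ ^ (n + 1))) t) *
          (‖fderiv ℝ f z‖ₑ * ‖z - x‖ₑ)
        ≤ ENNReal.ofReal (d ^ n / (n * ‖z - x‖ ^ n)) * (‖fderiv ℝ f z‖ₑ * ‖z - x‖ₑ) := by
          gcongr
          exact lintegral_Ioc_indicator_inv_pow_le hn hρ hd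
      _ = ENNReal.ofReal (d ^ n / n) * (‖fderiv ℝ f z‖ₑ * ENNReal.ofReal (‖z - x‖⁻¹ ^ (n - 1))) := by
          rw [← ofReal_norm (z - x),
            mul_left_comm (ENNReal.ofReal (d ^ n / (n * ‖z - x‖ ^ n))) (‖fderiv ℝ f z‖ₑ) (ENNReal.ofReal ‖z - x‖),
            ← ENNReal.ofReal_mul (by positivity),
            mul_left_comm (ENNReal.ofReal (d ^ n / n)) (‖fderiv ℝ f z‖ₑ) (ENNReal.ofReal (‖z - x‖⁻¹ ^ (n - 1))),
            ← ENNReal.ofReal_mul (by positivity)]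
          congr 2
          obtain ⟨m, hm⟩ : ∃ m, n = m + 1 := ⟨n - 1, (Nat.sub_add_cancel hn).symm⟩
          rw [hm, Nat.add_sub_cancel, pow_succ, inv_pow]
          field_simp
          ring
  -- ### assembly
  calc ‖f x - ⨍ y in S, f y ∂μ‖ₑ ≤ (μ S)⁻¹ * ∫⁻ y in S, ‖f x - f y‖ₑ ∂μ := enorm_sub_setAverage_le hS0 hStop hfi (f x)
    _ = (μ S)⁻¹ * ∫⁻ y in S, ‖f y - f x‖ₑ ∂μ := by
        congr 1; exact lintegral_congr fun y => enorm_sub_rev _ _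
    _ ≤ (μ S)⁻¹ * ∫⁻ t in Ioc (0 : ℝ) 1, (∫⁻ y in S, ‖fderiv ℝ f (x + t • (y - x)) (y - x)‖ₑ ∂μ) := by gcongr
    _ ≤ (μ S)⁻¹ * ∫⁻ t in Ioc (0 : ℝ) 1, (∫⁻ z in ball c R, K t z ∂μ) := by
        gcongr 1
        exact setLIntegral_mono' measurableSet_Ioc hK
    _ = (μ S)⁻¹ * ∫⁻ z in ball c R, (∫⁻ t in Ioc (0 : ℝ) 1, K t z) ∂μ := by rw [hD]
    _ ≤ (μ S)⁻¹ * ∫⁻ z in ball c R, ENNReal.ofReal (d ^ n / n) * (‖fderiv ℝ f z‖ₑ * ENNReal.ofReal (‖z - x‖⁻¹ ^ (n - 1))) ∂μ := by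
        gcongr 1
        exact lintegral_mono fun z => hE z
    _ = ENNReal.ofReal (d ^ n / n) / μ S * ∫⁻ z in ball c R, ‖fderiv ℝ f z‖ₑ * ENNReal.ofReal (‖z - x‖⁻¹ ^ (n - 1)) ∂μ := by
        rw [lintegral_const_mul' _ _ ENNReal.ofReal_ne_top, ← mul_assoc, ENNReal.div_eq_inv_mul]

end Main

end Literature.Analysis.FunctionSpaces

end
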